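import Summits.ValiantsHypothesis.ValiantsHypothesis.Theorems.TwoProducts.RankThreeWronskianTransfer
import Summits.ValiantsHypothesis.ValiantsHypothesis.Theorems.TwoProducts.RankTwoJacobianTower

/-!
# Rank three, part R3c-1 (`TowerKernel3`, R1 + R2): carriers `S3`, exceptional chart values `X3` (ALL pair crossings), ARCS, and the ECHELON basis

R1: `S3 w = S₀ ∪ S₁ ∪ S₂` (`card_S3_le : ≤ 3t`), `X3 σ w` = the crossing values of all pairs of carrier points (`card_X3_le : ≤ 9t²`),
`eq_of_wt_eq_S3` (off `X3` the chart weight is injective on `S3`), `tie_S3_mem_X3`, `isUniqueTop_iff`, `exists_utop3`, `wt_ne3`, arcs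
`idx3` / `OnArc` / `closedGap_of_onArc`, and the constancy lemmas along an arc `utop_const3` / ★ `utop_onArc` / ★ `sameSign3`.
R2: `isHomogeneous_pderiv3`, `isHomogeneous_bind₁_lin`, three support helpers, and ★★ `echelon3` — the per-arc ECHELON change of generators
(weak form: row 0 has the overall top carrier point as UNIQUE top, rows 1, 2 avoid it; `P' = P ∘ B⁻¹` stays homogeneous, `P'(w') = P(w)`).

Port (val-port-4 g4, desk RULING #498 (A)/#499; critic of record val-idea-crit-8 g4, VERDICT #47 «R3c PORT LICENCE») of `section TowerKernel3` (R1, R2) of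
val-idea-35 g10's crux workfile `Cruxes/TwoProducts/RankThreeWronskian_val_idea_35_g10.lean` REV 2 @1064d0978540 (sha16 d29beed995ebec39, 2064 l., farm rc 0 / 0 sorry / std axioms) — bodies VERBATIM,
namespace `…Cruxes.TwoProducts.ValIdea35g10` → `…Theorems.TwoProducts.RankTwoJacobian`; the g9 chart machinery (`Expo`, `dir`, `TieIn`, `IsUTop`, `cross`,
`eq_of_wt_eq`, `wt_eq_imp_cross`, `exists_tie_between`, `utop_unique`, `utop_between`, …) and the rank-three vocabulary (`Poly3`, `IsUniqueTop`, `wt`, …) are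
IMPORTED from the landed ✓ `…RankTwoJacobianTower*` (val-lit-p3 g18's P4 ports) and ✓ `…RankThreeWronskianRule/Transfer` (p3's R3a/R3b), never re-declared;
lint docstrings added to 10 helper lemmas.  Three files (400-line rule): this = R1+R2; `…RankThreeWronskianTowerLevels` = R3; `…RankThreeWronskianTower` = R4 + the law.
HONEST LABEL: helper/instance theorems for the SIDE ladder «table-rank-ladder» (K13, rung 3-LIN) of crux `stmt-ValiantsHypothesis-5906` (`TwoProducts`):
a class-(3,·) law with a crude constant; NOT γ; `RankThreeExplicitBound` (the sharp `t³ + 9t²(4m+1)`) and `PortPlan3` stay PAPER in the workfile and are NOT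
ported; nothing closes 5906 / `PlanarCellBound` / `ResidualLawV25`; 0 distance on the crux; VP ≠ VNP is NOT proved.  `--supports stmt-ValiantsHypothesis-5906
--as helper`.  Credit: val-idea-35 g10 (crit-8 g4 VERDICT #47 ★★).  No instances, no notation, no named facts. [folklore]
-/

noncomputable section
set_option linter.dupNamespace false

namespace Summit.ValiantsHypothesis.ValiantsHypothesis.Theorems.TwoProducts.RankTwoJacobian

open scoped BigOperators Pointwise Classical
open MvPolynomial

/-! ### Rank 3 — R1: the carrier set `S3`, the exceptional chart values `X3` (ALL pair crossings), arcs
Off `X3 σ w` the chart weight is injective on `S3 w`, so every nonzero `G` with `supp G ⊆ S3 w` has a unique top,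
and that top is constant along an arc (a maximal run of chart values with the same number of exceptional values
below it). -/

/-- the union of the three generator supports -/
def S3 (w : Fin 3 → Poly2) : Finset Expo := (w 0).support ∪ (w 1).support ∪ (w 2).support

/-- membership in the carrier set `S3 w = S₀ ∪ S₁ ∪ S₂`. -/
theorem mem_S3 {w : Fin 3 → Poly2} {a : Expo} : a ∈ S3 w ↔ ∃ i, a ∈ (w i).support := by
  unfold S3; simp only [Finset.mem_union]
  constructor
  · rintro ((h | h) | h)
    exacts [⟨0, h⟩, ⟨1, h⟩, ⟨2, h⟩]
  · rintro ⟨i, h⟩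
    fin_cases i
    exacts [Or.inl (Or.inl h), Or.inl (Or.inr h), Or.inr h]

/-- each generator is carried by `S3 w`. -/
theorem support_subset_S3 (w : Fin 3 → Poly2) (i : Fin 3) : (w i).support ⊆ S3 w :=
  fun _ h => mem_S3.mpr ⟨i, h⟩

/-- `|S3 w| ≤ 3t` when every generator has `≤ t` monomials. -/
theorem card_S3_le {w : Fin 3 → Poly2} {t : ℕ} (hw : ∀ i, (w i).support.card ≤ t) : (S3 w).card ≤ 3 * t := by
  unfold S3
  calc ((w 0).support ∪ (w 1).support ∪ (w 2).support).card
      ≤ ((w 0).support ∪ (w 1).support).card + (w 2).support.card := Finset.card_union_le _ _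
    _ ≤ ((w 0).support.card + (w 1).support.card) + (w 2).support.card :=
        Nat.add_le_add_right (Finset.card_union_le _ _) _
    _ ≤ (t + t) + t := Nat.add_le_add (Nat.add_le_add (hw 0) (hw 1)) (hw 2)
    _ = 3 * t := by ring

/-- exceptional chart values: the crossings of ALL pairs of carrier points with distinct first coordinate -/
def X3 (σ : ℝ) (w : Fin 3 → Poly2) : Finset ℝ :=
  ((S3 w ×ˢ S3 w).filter (fun ab => ab.1 0 ≠ ab.2 0)).image (fun ab => cross σ ab.1 ab.2)

/-- `|X3| ≤ 9t²`: at most `|S3|²` exceptional chart values (all pair crossings). -/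
theorem card_X3_le (σ : ℝ) {w : Fin 3 → Poly2} {t : ℕ} (hw : ∀ i, (w i).support.card ≤ t) :
    (X3 σ w).card ≤ 9 * t ^ 2 := by
  unfold X3
  refine Finset.card_image_le.trans ((Finset.card_filter_le _ _).trans ?_)
  rw [Finset.card_product]
  have h := card_S3_le hw
  calc (S3 w).card * (S3 w).card ≤ (3 * t) * (3 * t) := Nat.mul_le_mul h h
    _ = 9 * t ^ 2 := by ring

/-- the crossing value of two carrier points with distinct first coordinates is exceptional. -/
theorem cross_mem_X3 {σ : ℝ} {w : Fin 3 → Poly2} {a b : Expo} (ha : a ∈ S3 w) (hb : b ∈ S3 w)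
    (h0 : a 0 ≠ b 0) : cross σ a b ∈ X3 σ w := by
  unfold X3
  exact Finset.mem_image.mpr ⟨(a, b), Finset.mem_filter.mpr ⟨Finset.mem_product.mpr ⟨ha, hb⟩, h0⟩, rfl⟩

/-- off `X3` the chart weight is injective on the carrier set -/
theorem eq_of_wt_eq_S3 {σ : ℝ} (hσ : σ = 1 ∨ σ = -1) {w : Fin 3 → Poly2} {μ : ℝ} (hμ : μ ∉ X3 σ w)
    {a b : Expo} (ha : a ∈ S3 w) (hb : b ∈ S3 w) (hw : wt (dir σ μ) a = wt (dir σ μ) b) : a = b := by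
  by_cases h0 : a 0 = b 0
  · exact eq_of_wt_eq hσ h0 hw
  · have hμ' := wt_eq_imp_cross h0 hw
    rw [hμ'] at hμ
    exact absurd (cross_mem_X3 ha hb h0) hμ

/-- a tie inside the carrier set happens only at an exceptional chart value -/
theorem tie_S3_mem_X3 {σ : ℝ} (hσ : σ = 1 ∨ σ = -1) {w : Fin 3 → Poly2} {T : Finset Expo} (hT : T ⊆ S3 w)
    {μ : ℝ} (h : TieIn (dir σ μ) T) : μ ∈ X3 σ w := by
  obtain ⟨p, hp, q, hq, hpq, -, hqp⟩ := h
  have h0 : q 0 ≠ p 0 := fun h0 => hpq (eq_of_wt_eq hσ h0 hqp).symm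
  rw [wt_eq_imp_cross h0 hqp]
  exact cross_mem_X3 (hT hq) (hT hp) h0

/-- `IsUniqueTop ν G p` is `IsUTop ν G.support p` -/
theorem isUniqueTop_iff (ν : Fin 2 → ℝ) (G : Poly2) (p : Expo) : IsUniqueTop ν G p ↔ IsUTop ν G.support p :=
  Iff.rfl

/-- off `X3`, every nonzero `G` carried by `S3 w` has a unique top -/
theorem exists_utop3 {σ : ℝ} (hσ : σ = 1 ∨ σ = -1) {w : Fin 3 → Poly2} {μ : ℝ} (hμ : μ ∉ X3 σ w) {G : Poly2}
    (hG : G ≠ 0) (hsub : G.support ⊆ S3 w) : ∃ p, IsUniqueTop (dir σ μ) G p := by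
  obtain ⟨p, hp, hmax⟩ := Finset.exists_max_image G.support (wt (dir σ μ)) (support_nonempty' hG)
  exact ⟨p, hp, fun s hs hsp => lt_of_le_of_ne (hmax s hs) fun h => hsp (eq_of_wt_eq_S3 hσ hμ (hsub hs) (hsub hp) h)⟩

/-- off `X3`, two distinct carrier points have distinct weights -/
theorem wt_ne3 {σ : ℝ} (hσ : σ = 1 ∨ σ = -1) {w : Fin 3 → Poly2} {μ : ℝ} (hμ : μ ∉ X3 σ w) {a b : Expo}
    (ha : a ∈ S3 w) (hb : b ∈ S3 w) (hab : a ≠ b) : wt (dir σ μ) a ≠ wt (dir σ μ) b :=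
  fun h => hab (eq_of_wt_eq_S3 hσ hμ ha hb h)

/-- arc index: the number of exceptional chart values below `μ` -/
def idx3 (σ : ℝ) (w : Fin 3 → Poly2) (μ : ℝ) : ℕ := ((X3 σ w).filter (fun z => z < μ)).card

/-- the arc index is at most `|X3|`. -/
theorem idx3_le (σ : ℝ) (w : Fin 3 → Poly2) (μ : ℝ) : idx3 σ w μ ≤ (X3 σ w).card := Finset.card_filter_le _ _

/-- two chart values with the same arc index have no exceptional value between them. -/
theorem gap_of_idx3_eq {σ : ℝ} {w : Fin 3 → Poly2} {x y : ℝ} (_hxy : x < y) (h : idx3 σ w x = idx3 σ w y) :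
    ∀ z ∈ X3 σ w, ¬ (x < z ∧ z < y) := by
  rintro z hz ⟨hxz, hzy⟩
  have hsub : (X3 σ w).filter (fun z => z < x) ⊂ (X3 σ w).filter (fun z => z < y) := by
    rw [Finset.ssubset_iff_of_subset]
    · exact ⟨z, Finset.mem_filter.mpr ⟨hz, hzy⟩, fun h => by
        have := (Finset.mem_filter.mp h).2; linarith⟩
    · intro u hu
      obtain ⟨hu1, hu2⟩ := Finset.mem_filter.mp hu
      exact Finset.mem_filter.mpr ⟨hu1, by linarith⟩
  have := Finset.card_lt_card hsub
  unfold idx3 at h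
  omega

/-- `μ` lies on arc `b`: not exceptional, with `b` exceptional values below it -/
def OnArc (σ : ℝ) (w : Fin 3 → Poly2) (b : ℕ) (μ : ℝ) : Prop := μ ∉ X3 σ w ∧ idx3 σ w μ = b

/-- no exceptional value in the CLOSED interval between two points of one arc -/
theorem closedGap_of_onArc {σ : ℝ} {w : Fin 3 → Poly2} {b : ℕ} {x y : ℝ} (_hxy : x ≤ y) (hx : OnArc σ w b x)
    (hy : OnArc σ w b y) : ∀ z ∈ X3 σ w, ¬ (x ≤ z ∧ z ≤ y) := by
  rintro z hz ⟨hxz, hzy⟩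
  rcases eq_or_lt_of_le hxz with h | h
  · exact hx.1 (h ▸ hz)
  rcases eq_or_lt_of_le hzy with h' | h'
  · exact hy.1 (h' ▸ hz)
  exact gap_of_idx3_eq (lt_of_lt_of_le h h'.le) (hx.2.trans hy.2.symm) z hz ⟨h, h'⟩

/-- unique tops of an `S3`-carried polynomial are CONSTANT along an arc -/
theorem utop_const3 {σ : ℝ} (hσ : σ = 1 ∨ σ = -1) {w : Fin 3 → Poly2} {b : ℕ} {x y : ℝ} (hx : OnArc σ w b x)
    (hy : OnArc σ w b y) {G : Poly2} (hsub : G.support ⊆ S3 w) {p p' : Expo} (hp : IsUniqueTop (dir σ x) G p)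
    (hp' : IsUniqueTop (dir σ y) G p') : p = p' := by
  by_contra hne
  rcases lt_trichotomy x y with hxy | hxy | hxy
  · obtain ⟨μ, h1, h2, htie⟩ := exists_tie_between hσ G.support hxy hp hp' hne
    exact closedGap_of_onArc hxy.le hx hy μ (tie_S3_mem_X3 hσ hsub htie) ⟨h1.le, h2.le⟩
  · subst hxy; exact hne (utop_unique hp hp')
  · obtain ⟨μ, h1, h2, htie⟩ := exists_tie_between hσ G.support hxy hp' hp (Ne.symm hne)
    exact closedGap_of_onArc hxy.le hy hx μ (tie_S3_mem_X3 hσ hsub htie) ⟨h1.le, h2.le⟩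

/-- transport of a unique top along an arc -/
theorem utop_onArc {σ : ℝ} (hσ : σ = 1 ∨ σ = -1) {w : Fin 3 → Poly2} {b : ℕ} {x y : ℝ} (hx : OnArc σ w b x)
    (hy : OnArc σ w b y) {G : Poly2} (hG : G ≠ 0) (hsub : G.support ⊆ S3 w) {p : Expo}
    (hp : IsUniqueTop (dir σ x) G p) : IsUniqueTop (dir σ y) G p := by
  obtain ⟨p', hp'⟩ := exists_utop3 hσ hy.1 hG hsub
  rwa [utop_const3 hσ hx hy hsub hp hp']

/-- the SIGN of a weight difference of two carrier points is constant along an arc -/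
theorem sameSign3 {σ : ℝ} (_hσ : σ = 1 ∨ σ = -1) {w : Fin 3 → Poly2} {b : ℕ} {x y : ℝ} (hx : OnArc σ w b x)
    (hy : OnArc σ w b y) {p q : Expo} (hp : p ∈ S3 w) (hq : q ∈ S3 w) :
    (0 < wt (dir σ x) p - wt (dir σ x) q ↔ 0 < wt (dir σ y) p - wt (dir σ y) q) := by
  by_cases h0 : p 0 = q 0
  · have e : wt (dir σ x) p - wt (dir σ x) q = wt (dir σ y) p - wt (dir σ y) q := by
      rw [wt_sub_eq, wt_sub_eq, h0]; ring
    rw [e]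
  · have hc : cross σ p q ∈ X3 σ w := cross_mem_X3 hp hq h0
    rw [wt_sub_eq_cross x h0, wt_sub_eq_cross y h0]
    -- `cross σ p q` is not in the closed interval between `x` and `y`, so `x - c` and `y - c` have the same sign
    have key : (0 < x - cross σ p q ↔ 0 < y - cross σ p q) ∧ (x - cross σ p q < 0 ↔ y - cross σ p q < 0) := by
      rcases le_total x y with hxy | hxy
      · have h := closedGap_of_onArc hxy hx hy _ hc
        push Not at h
        constructor
        · constructor
          · intro h1; linarith
          · intro h1
            by_contra h2; push Not at h2
            have hxz : x ≤ cross σ p q := by linarith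
            have := h hxz; linarith
        · constructor
          · intro h1
            by_contra h2; push Not at h2
            have := h (by linarith); linarith
          · intro h1; linarith
      · have h := closedGap_of_onArc hxy hy hx _ hc
        push Not at h
        constructor
        · constructor
          · intro h1
            by_contra h2; push Not at h2
            have := h (by linarith); linarith
          · intro h1; linarith
        · constructor
          · intro h1; linarith
          · intro h1
            by_contra h2; push Not at h2
            have := h (by linarith); linarith
    have hd : (((p 0 : ℕ) : ℝ) - ((q 0 : ℕ) : ℝ)) ≠ 0 := sub_ne_zero_of_ne0 h0
    rcases lt_or_gt_of_ne hd with hneg | hpos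
    · rw [mul_pos_iff, mul_pos_iff]
      constructor
      · rintro (⟨h1, h2⟩ | ⟨h1, h2⟩)
        · exact absurd h2 (not_lt.mpr hneg.le)
        · exact Or.inr ⟨key.2.mp h1, h2⟩
      · rintro (⟨h1, h2⟩ | ⟨h1, h2⟩)
        · exact absurd h2 (not_lt.mpr hneg.le)
        · exact Or.inr ⟨key.2.mpr h1, h2⟩
    · rw [mul_pos_iff, mul_pos_iff]
      constructor
      · rintro (⟨h1, h2⟩ | ⟨h1, h2⟩)
        · exact Or.inl ⟨key.1.mp h1, h2⟩
        · exact absurd h2 (not_lt.mpr hpos.le)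
      · rintro (⟨h1, h2⟩ | ⟨h1, h2⟩)
        · exact Or.inl ⟨key.1.mpr h1, h2⟩
        · exact absurd h2 (not_lt.mpr hpos.le)

/-! ### Rank 3 — R2: homogeneity helpers and the ECHELON basis on an arc -/

/-- `∂/∂Xᵢ` lowers the degree of a homogeneous polynomial by one (the 7-line proof of
`Literature.Algebra.Polynomial.JacobianCriterion.isHomogeneous_pderiv`, Humphreys § 3.10, copied for `Fin 3`). -/
theorem isHomogeneous_pderiv3 {p : Poly3} {n : ℕ} (hp : p.IsHomogeneous n) (i : Fin 3) :
    (pderiv i p).IsHomogeneous (n - 1) := by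
  classical
  intro d hd
  rw [coeff_pderiv] at hd
  have h := hp (left_ne_zero_of_mul hd)
  rw [map_add, Finsupp.weight_single, smul_eq_mul, Pi.one_apply, mul_one] at h
  change Finsupp.weight 1 d = n - 1
  omega

/-- substitution of LINEAR FORMS preserves homogeneity -/
theorem isHomogeneous_bind₁_lin {P : Poly3} {m : ℕ} (hP : P.IsHomogeneous m) (L : Fin 3 → Poly3)
    (hL : ∀ i, (L i).IsHomogeneous 1) : (bind₁ L P).IsHomogeneous m := by
  classical
  rw [P.as_sum, map_sum]
  refine IsHomogeneous.sum _ _ _ fun d hd => ?_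
  rw [bind₁_monomial]
  have h := hP (mem_support_iff.mp hd)
  have hdeg : ∑ i ∈ d.support, 1 * d i = m := by
    have h' : Finsupp.weight (1 : Fin 3 → ℕ) d = m := h
    rw [Finsupp.weight_apply, Finsupp.sum] at h'
    simpa [smul_eq_mul] using h'
  rw [← zero_add m]
  refine (isHomogeneous_C _ _).mul ?_
  rw [← hdeg]
  exact IsHomogeneous.prod _ _ _ fun i _ => (hL i).pow (d i)

/-- `supp (b·G) ⊆ supp G`. -/
theorem mem_support_of_C_mul {b : ℂ} {G : Poly2} {s : Expo} (hs : s ∈ (C b * G).support) : s ∈ G.support := by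
  rw [mem_support_iff, coeff_C_mul] at hs
  exact mem_support_iff.mpr (right_ne_zero_of_mul hs)

/-- `supp (G − b·H) ⊆ S` when `supp G, supp H ⊆ S`. -/
theorem support_sub_C_mul_subset {G H : Poly2} {b : ℂ} {S : Finset Expo} (hG : G.support ⊆ S) (hH : H.support ⊆ S) :
    (G - C b * H).support ⊆ S := by
  intro s hs
  rcases Finset.mem_union.mp ((MvPolynomial.support_sub ..) hs) with h | h
  · exact hG h
  · exact hH (mem_support_of_C_mul h)

/-- the elimination `G − (G_p/H_p)·H` kills the monomial `X^p`. -/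
theorem not_mem_support_elim {G H : Poly2} {p : Expo} (hc : coeff p H ≠ 0) :
    p ∉ (G - C (coeff p G / coeff p H) * H).support := by
  intro h
  apply mem_support_iff.mp h
  rw [coeff_sub, coeff_C_mul]
  field_simp
  ring

/-- THE ECHELON LEMMA (weak form = what the transfer needs): at a non-exceptional chart value `μ₀` there is a
change of generators `w' = B·w` (B = permutation ∘ unipotent, so invertible) and `P' = P ∘ B⁻¹` homogeneous of the
same degree with `P'(w') = P(w)`, all rows carried by `S3 w`, row 0 having the overall top carrier point `p₀` as its
UNIQUE top and rows 1, 2 not containing `p₀`.  (Row 1's unique top `p₁ ≠ p₀`, when row 1 is nonzero, then exists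
by `exists_utop3` and has a different weight by injectivity; both tops are constant along the arc by `utop_onArc`.) -/
theorem echelon3 {σ : ℝ} (hσ : σ = 1 ∨ σ = -1) {w : Fin 3 → Poly2} (hne : (S3 w).Nonempty) {μ₀ : ℝ}
    (hμ : μ₀ ∉ X3 σ w) (P : Poly3) {m : ℕ} (hP : P.IsHomogeneous m) :
    ∃ (w' : Fin 3 → Poly2) (P' : Poly3) (p₀ : Expo), P'.IsHomogeneous m ∧ aeval w' P' = aeval w P ∧
      (∀ i, (w' i).support ⊆ S3 w) ∧ IsUniqueTop (dir σ μ₀) (w' 0) p₀ ∧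
      p₀ ∉ (w' 1).support ∧ p₀ ∉ (w' 2).support := by
  classical
  -- the overall top carrier point `p₀` and a generator `w a` containing it
  obtain ⟨p₀, hp₀S, hmax⟩ := Finset.exists_max_image (S3 w) (wt (dir σ μ₀)) hne
  obtain ⟨a, ha⟩ := mem_S3.mp hp₀S
  -- permute so that this generator comes first
  set π : Equiv.Perm (Fin 3) := Equiv.swap 0 a with hπ
  set wπ : Fin 3 → Poly2 := w ∘ π with hwπ
  have hwπ0 : wπ 0 = w a := by simp [hwπ, hπ]
  have hSπ : ∀ i, (wπ i).support ⊆ S3 w := fun i => support_subset_S3 w (π i)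
  set Pπ : Poly3 := rename π P with hPπ
  have hPπ_hom : Pπ.IsHomogeneous m := hP.rename_isHomogeneous
  have hev1 : aeval wπ Pπ = aeval w P := by
    rw [hPπ, aeval_rename]
    have hfun : (wπ ∘ ⇑π : Fin 3 → Poly2) = w := by
      funext i; simp [hwπ, hπ, Function.comp, Equiv.swap_apply_self]
    rw [hfun]
  -- eliminate `p₀` from generators 1 and 2
  have hc0 : coeff p₀ (wπ 0) ≠ 0 := by rw [hwπ0]; exact mem_support_iff.mp ha
  set β : ℂ := coeff p₀ (wπ 1) / coeff p₀ (wπ 0) with hβ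
  set γ : ℂ := coeff p₀ (wπ 2) / coeff p₀ (wπ 0) with hγ
  set L : Fin 3 → Poly3 := ![X 0, X 1 + C β * X 0, X 2 + C γ * X 0] with hL
  refine ⟨![wπ 0, wπ 1 - C β * wπ 0, wπ 2 - C γ * wπ 0], bind₁ L Pπ, p₀, ?_, ?_, ?_, ?_, ?_, ?_⟩
  · -- homogeneity of `P' = Pπ ∘ L`
    refine isHomogeneous_bind₁_lin hPπ_hom L fun i => ?_
    fin_cases i
    · exact isHomogeneous_X ℂ 0
    · exact (isHomogeneous_X ℂ 1).add ((isHomogeneous_X ℂ 0).C_mul β)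
    · exact (isHomogeneous_X ℂ 2).add ((isHomogeneous_X ℂ 0).C_mul γ)
  · -- evaluation: `P'(w') = Pπ(wπ) = P(w)`
    rw [← hev1, aeval_bind₁]
    have hfun : (fun i => aeval ![wπ 0, wπ 1 - C β * wπ 0, wπ 2 - C γ * wπ 0] (L i)) = wπ := by
      funext i
      fin_cases i
      · simp [hL]
      · simp [hL, MvPolynomial.algebraMap_eq]
      · simp [hL, MvPolynomial.algebraMap_eq]
    rw [hfun]
  · intro i
    fin_cases i
    · exact hSπ 0
    · exact support_sub_C_mul_subset (hSπ 1) (hSπ 0)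
    · exact support_sub_C_mul_subset (hSπ 2) (hSπ 0)
  · -- unique top of row 0 = `w a` at `μ₀` is `p₀`
    refine ⟨?_, fun s hs hsp => ?_⟩
    · show p₀ ∈ (wπ 0).support
      rw [hwπ0]; exact ha
    · have hsS : s ∈ S3 w := hSπ 0 hs
      exact lt_of_le_of_ne (hmax s hsS) (wt_ne3 hσ hμ hsS hp₀S hsp)
  · exact not_mem_support_elim hc0
  · exact not_mem_support_elim hc0

end Summit.ValiantsHypothesis.ValiantsHypothesis.Theorems.TwoProducts.RankTwoJacobian

end
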